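import Literature.MathematicalPhysics.QuantumFieldTheory.YangMillsOS
import Literature.RepresentationTheory.CompactGroups.GaussianCentreSplitting
import HarnessLib

/-!
# Crux `NonSimplyConnectedLatticeGap` (stmt-QuantumFields-16405), route `ConvexGribovBody`,
# line `twist-equipartition-blindness` — stub `stub_centreSplitting` (SPLIT), first rigorous
# instance: kernel of order two, adjoint-type blind weight (`SU(2) → SO(3)`)

The stub SPLIT asks, for a cover datum `π : H → G` (finite central kernel) with a faithful unitary
representation `ρH` of `H` (defining the cells) and the crux's representation `r` of `G`
(defining the centre-BLIND Wilson weight `E(h) = exp (β Re tr r(π h))`), for a continuous,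
non-negative, symmetric, central, POSITIVE-TYPE function `w` on `H` with
`Σ_{k ∈ ker π} w(k h) = E(h)` EXACTLY and only an `e^{-cβ}` fraction of mass in the wrong cell.

Here we land it under three extra hypotheses describing the datum `SU(2) → SO(3)` with `ρH` the
fundamental and `r` the vector representation (`tr_{SO(3)} = (tr_{SU(2)})² − 1`):
* the kernel has order two, `ker π = {1, k₀}`;
* the faithful representation sees `k₀` as `−1`, `ρH(k₀) = −1`;
* the blind weight is of adjoint type, `Re tr r(π h) = (Re tr ρH(h))² − 1`.

Mechanism (no character theory): GAUSSIAN SUBORDINATION,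
`Literature.RepresentationTheory.CompactGroups.exists_posType_gaussian_splitting` — with
`χ = Re tr ρH` (continuous, symmetric, central, of positive type because `ρH` is unitary:
`Σ cᵢ cⱼ Re tr ρ(xᵢ)ᴴ ρ(xⱼ) = Re tr Aᴴ A ≥ 0`, `A = Σ cⱼ ρ(xⱼ)`), the function
`w_β = e^{-β} (4πβ)^{-1/2} ∫_0^∞ e^{-s²/(4β)} e^{s χ} ds` is of positive type (Schur), satisfies
`w_β(h) + w_β(k₀ h) = e^{-β} e^{β χ²} = E(h)` (moment generating function; `χ(k₀ h) = −χ(h)`), and on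
the cell `{χ > 0}` the defect `E − w_β` is at most `e^{-β}/2`, while
`∫ w_β ≥ e^{-β} · ½ e^{β/4} · Haar{χ > 1/2}` (an open neighbourhood of `1`, charged by Haar measure);
so `c = 1/8` and `β_s = max 1 (−8 log Haar{χ > 1/2})` do.

Main results: `centreSplitting_of_kerOrderTwo` — the conclusion of `stub_centreSplitting` verbatim,
in the stub's context, under the three extra hypotheses — and the product form
`centreSplitting_of_kerOrderTwo_of_posType`, where the blind weight is allowed an extra additive
term `F` that is continuous, `ker π`-invariant, symmetric, central and of positive type
(`Re tr r(π h) = (Re tr ρH(h))² − 1 + F(h)`: every faithful `r` of `SO(3)` containing the vector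
representation); the splitting is then `e^{-β} w e^{β F}` (Schur product). The general stub
(arbitrary finite central kernel and arbitrary `r`) stays open.
-/

set_option autoImplicit false

noncomputable section

open MeasureTheory Set Filter
open scoped BigOperators ComplexOrder Matrix
open Literature.MathematicalPhysics.QuantumFieldTheory
open Literature.RepresentationTheory.CompactGroups Literature.Analysis.Matrix

namespace Summit.QuantumFields.YangMills.Theorems.NonSimplyConnectedLatticeGap

/-! ### The real character `Re tr ρH` of a unitary lattice representation -/

section Character

variable {H : Type} [Group H] [TopologicalSpace H]

/-- A unitary representation maps inverses to conjugate transposes (cf.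
`LatticeRep.map_inv_eq_conjTranspose` in `WilsonPartitionLaplaceForm`, reproved to keep the
import closure small). [folklore] -/
theorem latticeRep_map_inv (ρH : LatticeRep H) (h : H) : ρH.ρ h⁻¹ = (ρH.ρ h)ᴴ := by
  have h1 : ρH.ρ h⁻¹ * ρH.ρ h = 1 := by rw [← map_mul, inv_mul_cancel, map_one]
  have h2 : ρH.ρ h * (ρH.ρ h)ᴴ = 1 := Matrix.mem_unitaryGroup_iff.1 (ρH.mem_unitary h)
  calc ρH.ρ h⁻¹ = ρH.ρ h⁻¹ * (ρH.ρ h * (ρH.ρ h)ᴴ) := by rw [h2, mul_one]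
    _ = (ρH.ρ h)ᴴ := by rw [← mul_assoc, h1, one_mul]

/-- `Re tr ρH` is continuous. [folklore] -/
theorem continuous_reTrace (ρH : LatticeRep H) : Continuous fun h => (ρH.ρ h).trace.re :=
  Complex.continuous_re.comp ρH.continuous.matrix_trace

/-- `Re tr ρH` is symmetric: `Re tr ρ(h⁻¹) = Re tr ρ(h)ᴴ = Re tr ρ(h)`. [folklore] -/
theorem reTrace_inv (ρH : LatticeRep H) (h : H) : (ρH.ρ h⁻¹).trace.re = (ρH.ρ h).trace.re := by
  rw [latticeRep_map_inv, Matrix.trace_conjTranspose, Complex.star_def, Complex.conj_re]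

/-- `Re tr ρH` is a class function. [folklore] -/
theorem reTrace_conj (ρH : LatticeRep H) (g h : H) :
    (ρH.ρ (g * h * g⁻¹)).trace.re = (ρH.ρ h).trace.re := by
  rw [map_mul, map_mul, Matrix.trace_mul_cycle, ← map_mul, inv_mul_cancel, map_one, one_mul]

/-- `Re tr ρH` is of (real) positive type: `Σ cᵢ cⱼ Re tr ρ(xᵢ⁻¹ xⱼ) = Re tr (Aᴴ A) ≥ 0` with
`A = Σ cⱼ ρ(xⱼ)`, because `ρ(xᵢ⁻¹) = ρ(xᵢ)ᴴ` for a unitary representation. [folklore] -/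
theorem reTrace_posType (ρH : LatticeRep H) (n : ℕ) (x : Fin n → H) (c : Fin n → ℝ) :
    0 ≤ ∑ i, ∑ j, c i * c j * (ρH.ρ ((x i)⁻¹ * x j)).trace.re := by
  have key : ((∑ i, (c i : ℂ) • ρH.ρ (x i))ᴴ * ∑ j, (c j : ℂ) • ρH.ρ (x j)).trace.re =
      ∑ i, ∑ j, c i * c j * (ρH.ρ ((x i)⁻¹ * x j)).trace.re := by
    rw [Matrix.conjTranspose_sum, Finset.sum_mul]
    simp only [Matrix.conjTranspose_smul, Complex.star_def, Complex.conj_ofReal, Finset.mul_sum,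
      Matrix.smul_mul, Matrix.mul_smul, Matrix.trace_sum, Matrix.trace_smul, smul_eq_mul,
      Complex.re_sum, Complex.re_ofReal_mul, map_mul, latticeRep_map_inv]
    exact Finset.sum_congr rfl fun i _ => Finset.sum_congr rfl fun j _ => by ring
  rw [← key]
  exact (Complex.nonneg_iff.mp (Matrix.posSemidef_conjTranspose_mul_self _).trace_nonneg).1

/-- `Re tr ρH(1) = N`. [folklore] -/
theorem reTrace_one (ρH : LatticeRep H) : (ρH.ρ 1).trace.re = ρH.N := by
  rw [map_one, Matrix.trace_one, Fintype.card_fin, Complex.natCast_re]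

end Character

/-- A symmetric function of (real) positive type on a group is bounded above by its value at `1`:
testing on `x = (1, h)`, `c = (1, -1)` gives `2 f(1) − f(h) − f(h⁻¹) ≥ 0`. [folklore] -/
theorem apply_le_apply_one_of_posType {H : Type*} [Group H] {f : H → ℝ} (hfi : ∀ h, f h⁻¹ = f h)
    (hfp : ∀ (n : ℕ) (x : Fin n → H) (c : Fin n → ℝ),
      0 ≤ ∑ i, ∑ j, c i * c j * f ((x i)⁻¹ * x j))
    (h : H) : f h ≤ f 1 := by
  have h0 := hfp 2 ![1, h] ![1, -1]
  simp only [Fin.sum_univ_two, Matrix.cons_val_zero, Matrix.cons_val_one, inv_one, one_mul,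
    mul_one, inv_mul_cancel, hfi, mul_neg, neg_mul, neg_neg] at h0
  linarith

/-! ### SPLIT for a kernel of order two and an adjoint-type-plus-positive-type blind weight -/

/-- **SPLIT for `|ker π| = 2` (product form).** In the context of `stub_centreSplitting`, assume
moreover that `ker π = {1, k₀}` with `k₀ ≠ 1`, that the faithful representation sees `k₀` as `−1`
(`ρH(k₀) = −1`), and that the centre-blind weight decomposes as
`Re tr r(π h) = (Re tr ρH(h))² − 1 + F(h)` with `F` continuous, `ker π`-invariant, symmetric, central
and of (real) positive type — for `SU(2) → SO(3)` this is every faithful `r` containing the vector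
representation (`F` = real character of the complement, pulled back). Then the stub's conclusion
holds with `c = 1/8`: `w_β(h) = e^{-β} w(h) e^{β F(h)}` with `w` the Gaussian subordination splitting of
`exp (β (Re tr ρH)²)` (`exists_posType_gaussian_splitting`) is continuous, non-negative, symmetric,
central, of positive type (Schur product), satisfies `w_β(h) + w_β(k₀ h) = exp (β Re tr r(π h))`
exactly, its defect on the cell `{Re tr ρH > 0}` is at most `e^{-β} e^{β F(1)}/2` (`F ≤ F(1)` by
positive type), and `∫ w_β ≥ e^{-β} ½ e^{β/4} e^{β (F(1) − 1/16)} · Haar(U)` on the open neighbourhood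
`U = {Re tr ρH > 1/2, F > F(1) − 1/16}` of `1`. [folklore] -/
theorem centreSplitting_of_kerOrderTwo_of_posType (G : Type) [Group G] [TopologicalSpace G]
    [IsTopologicalGroup G] [CompactSpace G] [MeasurableSpace G] [BorelSpace G]
    (_hG : Literature.MathematicalPhysics.QuantumFieldTheory.IsCompactSimpleLieGroup G) (H : Type)
    [Group H] [TopologicalSpace H] [IsTopologicalGroup H] [CompactSpace H] [MeasurableSpace H]
    [BorelSpace H] (_hH : Literature.MathematicalPhysics.QuantumFieldTheory.IsCompactSimpleLieGroup H)
    (_hH₁ : SimplyConnectedSpace H) (π : H →* G) (hπ : Continuous π) (_hπs : Function.Surjective π)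
    (_hπZ : π.ker ≤ Subgroup.center H) (_hπf : (π.ker : Set H).Finite) (_hπ1 : π.ker ≠ ⊥)
    (ρH : Literature.MathematicalPhysics.QuantumFieldTheory.LatticeRep H)
    (r : Literature.MathematicalPhysics.QuantumFieldTheory.LatticeRep G)
    (k₀ : H) (hk₀ : k₀ ∈ π.ker) (hk₀1 : k₀ ≠ 1) (hk2 : ∀ k ∈ π.ker, k = 1 ∨ k = k₀)
    (hρk : ρH.ρ k₀ = -1) (F : H → ℝ) (hFc : Continuous F) (hFk : ∀ k ∈ π.ker, ∀ h, F (k * h) = F h)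
    (hFi : ∀ h, F h⁻¹ = F h) (hFcl : ∀ g h, F (g * h * g⁻¹) = F h)
    (hFp : ∀ (n : ℕ) (x : Fin n → H) (c : Fin n → ℝ),
      0 ≤ ∑ i, ∑ j, c i * c j * F ((x i)⁻¹ * x j))
    (hr : ∀ h, (r.ρ (π h)).trace.re = (ρH.ρ h).trace.re ^ 2 - 1 + F h) :
    ∃ c : ℝ, 0 < c ∧ ∃ β_s : ℝ, ∀ β : ℝ, β_s ≤ β → (∃
    w : H → ℝ, Continuous w ∧ (∀ h, 0 ≤ w h) ∧ (∀ h, w h⁻¹ = w h) ∧ (∀ g h, w (g * h * g⁻¹) = w h) ∧ (∀ (n : ℕ) (x :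
    Fin n → H) (v : Fin n → ℂ), 0 ≤ (∑ i, ∑ j, (starRingEnd ℂ) (v i) * v j * ((w ((x i)⁻¹ * x j) : ℝ) : ℂ)).re) ∧ (∀
    h, ∑ᶠ k ∈ (π.ker : Set H), w (k * h) = Real.exp (β * (r.ρ (π h)).trace.re)) ∧ (∫ h in {h : H | (∀ k' : H, k' ∈
    π.ker → k' ≠ 1 → (ρH.ρ (k'⁻¹ * h)).trace.re < (ρH.ρ h).trace.re)}, (Real.exp (β * (r.ρ (π h)).trace.re) - w h)
    ∂(Literature.MathematicalPhysics.QuantumFieldTheory.haarProbability H) ≤ Real.exp (-(c * β)) * ∫ h, w h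
    ∂(Literature.MathematicalPhysics.QuantumFieldTheory.haarProbability H))) := by
  set μ : Measure H := Literature.MathematicalPhysics.QuantumFieldTheory.haarProbability H with hμ
  haveI : μ.IsOpenPosMeasure := by
    rw [hμ]
    unfold Literature.MathematicalPhysics.QuantumFieldTheory.haarProbability
    infer_instance
  -- the real character `χ = Re tr ρH`, the involution `k₀`, the maximum of `F`
  have hχc := continuous_reTrace ρH
  have hk₀inv : k₀⁻¹ = k₀ := by
    rcases hk2 (k₀ * k₀) (π.ker.mul_mem hk₀ hk₀) with h | h
    · exact inv_eq_of_mul_eq_one_right h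
    · exact absurd (mul_left_cancel (h.trans (mul_one k₀).symm)) hk₀1
  have hχk : ∀ h, (ρH.ρ (k₀ * h)).trace.re = -(ρH.ρ h).trace.re := fun h => by
    rw [map_mul, hρk, neg_mul, one_mul, Matrix.trace_neg, Complex.neg_re]
  have hχk' : ∀ h, (ρH.ρ (k₀⁻¹ * h)).trace.re = -(ρH.ρ h).trace.re := fun h => by
    rw [hk₀inv]
    exact hχk h
  have hN : 0 < ρH.N := by
    refine Nat.pos_of_ne_zero fun hN => hk₀1 (ρH.injective ?_)
    rw [map_one, hρk]
    exact Matrix.ext fun i _ => absurd i.2 (by omega)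
  have hF1 : ∀ h, F h ≤ F 1 := apply_le_apply_one_of_posType hFi hFp
  -- the open neighbourhood `U = {χ > 1/2, F > F 1 - 1/16}` of `1`, charged by Haar measure
  set U : Set H := {h | 1 / 2 < (ρH.ρ h).trace.re} ∩ {h | F 1 - 1 / 16 < F h} with hU
  have hUo : IsOpen U := (isOpen_lt continuous_const hχc).inter (isOpen_lt continuous_const hFc)
  have h1U : (1 : H) ∈ U := by
    have h1 : (1 : ℝ) ≤ ρH.N := by exact_mod_cast hN
    refine ⟨?_, ?_⟩
    · show 1 / 2 < (ρH.ρ 1).trace.re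
      rw [reTrace_one]
      linarith
    · show F 1 - 1 / 16 < F 1
      linarith
  have hUpos : 0 < μ.real U :=
    ENNReal.toReal_pos (hUo.measure_pos μ ⟨1, h1U⟩).ne' (measure_ne_top μ U)
  -- constants
  refine ⟨1 / 8, by norm_num, max 1 (-16 * Real.log (μ.real U)), fun β hβ => ?_⟩
  have hβ1 : 1 ≤ β := le_trans (le_max_left _ _) hβ
  have hβ0 : 0 < β := by linarith
  have hβlog : -16 * Real.log (μ.real U) ≤ β := le_trans (le_max_right _ _) hβ
  -- Gaussian subordination for `χ = Re tr ρH`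
  obtain ⟨w, hwc, hw0, hwi, hwcl, hwpr, -, hwex, hwle, hwnoise⟩ :=
    exists_posType_gaussian_splitting (fun h => (ρH.ρ h).trace.re) hχc (reTrace_inv ρH)
      (reTrace_conj ρH) (reTrace_posType ρH) hβ0
  have hE : ∀ h, Real.exp (β * (r.ρ (π h)).trace.re) =
      Real.exp (-β) * (Real.exp (β * (ρH.ρ h).trace.re ^ 2) * Real.exp (β * F h)) := fun h => by
    rw [hr, ← Real.exp_add, ← Real.exp_add]
    congr 1
    ring
  have hwFc : Continuous fun h => w h * Real.exp (β * F h) := hwc.mul (hFc.const_mul β).rexp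
  have hwF0 : ∀ h, 0 ≤ w h * Real.exp (β * F h) := fun h => mul_nonneg (hw0 h) (Real.exp_pos _).le
  have hint_w : Integrable (fun h => w h * Real.exp (β * F h)) μ :=
    hwFc.integrable_of_hasCompactSupport (HasCompactSupport.of_compactSpace _)
  -- positive type of the product (Schur)
  have hKw : IsPosDefKernel fun x y : H => w (x⁻¹ * y) :=
    ⟨fun x y => by
      show w (x⁻¹ * y) = w (y⁻¹ * x)
      rw [← hwi (x⁻¹ * y), mul_inv_rev, inv_inv], hwpr⟩
  have hKF : IsPosDefKernel fun x y : H => F (x⁻¹ * y) :=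
    ⟨fun x y => by
      show F (x⁻¹ * y) = F (y⁻¹ * x)
      rw [← hFi (x⁻¹ * y), mul_inv_rev, inv_inv], hFp⟩
  have hprod : ∀ (n : ℕ) (x : Fin n → H) (c : Fin n → ℝ),
      0 ≤ ∑ i, ∑ j, c i * c j * (w ((x i)⁻¹ * x j) * Real.exp (β * F ((x i)⁻¹ * x j))) :=
    (hKw.mul (hKF.const_mul hβ0.le).exp).2
  refine ⟨fun h => Real.exp (-β) * (w h * Real.exp (β * F h)), continuous_const.mul hwFc,
    fun h => mul_nonneg (Real.exp_pos _).le (hwF0 h), fun h => by simp only [hwi, hFi],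
    fun g h => by simp only [hwcl, hFcl], fun n x v => ?_, fun h => ?_, ?_⟩
  · -- positive type survives the scaling by `e^{-β} ≥ 0`
    have e : (∑ i, ∑ j, (starRingEnd ℂ) (v i) * v j *
        ((Real.exp (-β) * (w ((x i)⁻¹ * x j) * Real.exp (β * F ((x i)⁻¹ * x j))) : ℝ) : ℂ)) =
        (Real.exp (-β) : ℂ) * ∑ i, ∑ j, (starRingEnd ℂ) (v i) * v j *
          ((w ((x i)⁻¹ * x j) * Real.exp (β * F ((x i)⁻¹ * x j)) : ℝ) : ℂ) := by
      rw [Finset.mul_sum]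
      refine Finset.sum_congr rfl fun i _ => ?_
      rw [Finset.mul_sum]
      refine Finset.sum_congr rfl fun j _ => ?_
      push_cast
      ring
    show 0 ≤ (∑ i, ∑ j, (starRingEnd ℂ) (v i) * v j *
      ((Real.exp (-β) * (w ((x i)⁻¹ * x j) * Real.exp (β * F ((x i)⁻¹ * x j))) : ℝ) : ℂ)).re
    rw [e, Complex.re_ofReal_mul]
    exact mul_nonneg (Real.exp_pos _).le
      (re_sum_conj_mul_nonneg_of_real (f := fun h => w h * Real.exp (β * F h)) hprod n x v)
  · -- exactness of the splitting over `ker π = {1, k₀}`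
    have hker : (π.ker : Set H) = {1, k₀} := by
      ext k
      simp only [SetLike.mem_coe, Set.mem_insert_iff, Set.mem_singleton_iff]
      exact ⟨fun hk => hk2 k hk, fun hk => by
        rcases hk with rfl | rfl
        exacts [π.ker.one_mem, hk₀]⟩
    show ∑ᶠ k ∈ (π.ker : Set H), Real.exp (-β) * (w (k * h) * Real.exp (β * F (k * h))) =
      Real.exp (β * (r.ρ (π h)).trace.re)
    rw [hker, finsum_mem_pair hk₀1.symm, one_mul, hFk k₀ hk₀ h, hE h, ← hwex h (k₀ * h) (hχk h)]
    ring
  · -- the wrong-cell mass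
    have hC : {h : H | (∀ k' : H, k' ∈ π.ker → k' ≠ 1 →
        (ρH.ρ (k'⁻¹ * h)).trace.re < (ρH.ρ h).trace.re)} = {h | 0 < (ρH.ρ h).trace.re} := by
      ext h
      simp only [Set.mem_setOf_eq]
      constructor
      · intro hh
        have h1 := hh k₀ hk₀ hk₀1
        rw [hχk'] at h1
        linarith
      · intro hh k' hk' hk'1
        rcases hk2 k' hk' with rfl | rfl
        · exact absurd rfl hk'1
        · rw [hχk']
          linarith
    beta_reduce
    rw [hC]
    have hmeas : MeasurableSet {h : H | 0 < (ρH.ρ h).trace.re} :=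
      (isOpen_lt continuous_const hχc).measurableSet
    have hint_E : Integrable (fun h => Real.exp (β * (r.ρ (π h)).trace.re) -
        Real.exp (-β) * (w h * Real.exp (β * F h))) μ :=
      (((Complex.continuous_re.comp (r.continuous.comp hπ).matrix_trace).const_mul β).rexp.sub
        (continuous_const.mul hwFc)).integrable_of_hasCompactSupport
        (HasCompactSupport.of_compactSpace _)
    -- LHS ≤ e^{-β} e^{β F 1} / 2
    have hLHS : ∫ h in {h | 0 < (ρH.ρ h).trace.re}, (Real.exp (β * (r.ρ (π h)).trace.re) -
        Real.exp (-β) * (w h * Real.exp (β * F h))) ∂μ ≤ Real.exp (-β) * Real.exp (β * F 1) / 2 :=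
      calc ∫ h in {h | 0 < (ρH.ρ h).trace.re}, (Real.exp (β * (r.ρ (π h)).trace.re) -
            Real.exp (-β) * (w h * Real.exp (β * F h))) ∂μ
          ≤ ∫ h in {h | 0 < (ρH.ρ h).trace.re}, Real.exp (-β) * Real.exp (β * F 1) / 2 ∂μ := by
            refine setIntegral_mono_on hint_E.integrableOn integrableOn_const hmeas fun h hh => ?_
            rw [hE h]
            have hd0 : 0 ≤ Real.exp (β * (ρH.ρ h).trace.re ^ 2) - w h := sub_nonneg.2 (hwle h)
            have hd : Real.exp (β * (ρH.ρ h).trace.re ^ 2) - w h ≤ 1 / 2 := hwnoise h (le_of_lt hh)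
            have hFe : Real.exp (β * F h) ≤ Real.exp (β * F 1) :=
              Real.exp_le_exp.2 (mul_le_mul_of_nonneg_left (hF1 h) hβ0.le)
            have h2 : Real.exp (β * F h) * (Real.exp (β * (ρH.ρ h).trace.re ^ 2) - w h) ≤
                Real.exp (β * F 1) * (1 / 2) := mul_le_mul hFe hd hd0 (Real.exp_pos _).le
            calc Real.exp (-β) * (Real.exp (β * (ρH.ρ h).trace.re ^ 2) * Real.exp (β * F h)) -
                  Real.exp (-β) * (w h * Real.exp (β * F h))
                = Real.exp (-β) * (Real.exp (β * F h) *
                    (Real.exp (β * (ρH.ρ h).trace.re ^ 2) - w h)) := by ring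
              _ ≤ Real.exp (-β) * (Real.exp (β * F 1) * (1 / 2)) :=
                  mul_le_mul_of_nonneg_left h2 (Real.exp_pos _).le
              _ = Real.exp (-β) * Real.exp (β * F 1) / 2 := by ring
        _ = μ.real {h | 0 < (ρH.ρ h).trace.re} * (Real.exp (-β) * Real.exp (β * F 1) / 2) := by
            rw [setIntegral_const, smul_eq_mul]
        _ ≤ 1 * (Real.exp (-β) * Real.exp (β * F 1) / 2) :=
            mul_le_mul_of_nonneg_right measureReal_le_one (by positivity)
        _ = Real.exp (-β) * Real.exp (β * F 1) / 2 := one_mul _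
    -- RHS ≥ e^{-β} e^{β F 1} / 2
    have hRHS : Real.exp (-β) * Real.exp (β * F 1) / 2 ≤
        Real.exp (-(1 / 8 * β)) * ∫ h, Real.exp (-β) * (w h * Real.exp (β * F h)) ∂μ := by
      rw [integral_const_mul]
      have h1 : 1 / 2 * Real.exp (β / 4) * Real.exp (β * (F 1 - 1 / 16)) * μ.real U ≤
          ∫ h, w h * Real.exp (β * F h) ∂μ :=
        calc 1 / 2 * Real.exp (β / 4) * Real.exp (β * (F 1 - 1 / 16)) * μ.real U
            = ∫ _ in U, 1 / 2 * Real.exp (β / 4) * Real.exp (β * (F 1 - 1 / 16)) ∂μ := by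
              rw [setIntegral_const, smul_eq_mul, mul_comm]
          _ ≤ ∫ h in U, w h * Real.exp (β * F h) ∂μ := by
              refine setIntegral_mono_on integrableOn_const hint_w.integrableOn hUo.measurableSet
                fun h hh => ?_
              have hh₁ : 1 / 2 < (ρH.ρ h).trace.re := hh.1
              have hh₂ : F 1 - 1 / 16 < F h := hh.2
              have hn := hwnoise h (by linarith)
              have hsq : 1 / 4 ≤ (ρH.ρ h).trace.re ^ 2 := by
                nlinarith [sq_nonneg ((ρH.ρ h).trace.re - 1 / 2)]
              have hexp : Real.exp (β / 4) ≤ Real.exp (β * (ρH.ρ h).trace.re ^ 2) :=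
                Real.exp_le_exp.2 (by linarith [mul_le_mul_of_nonneg_left hsq hβ0.le])
              have hone : 1 ≤ Real.exp (β / 4) := Real.one_le_exp (by positivity)
              have hwlb : 1 / 2 * Real.exp (β / 4) ≤ w h := by linarith
              have hFlb : Real.exp (β * (F 1 - 1 / 16)) ≤ Real.exp (β * F h) :=
                Real.exp_le_exp.2 (mul_le_mul_of_nonneg_left hh₂.le hβ0.le)
              exact mul_le_mul hwlb hFlb (Real.exp_pos _).le (hw0 h)
          _ ≤ ∫ h, w h * Real.exp (β * F h) ∂μ :=
              setIntegral_le_integral hint_w (Eventually.of_forall hwF0)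
      have h2 : 1 ≤ Real.exp (β / 16) * μ.real U := by
        have hlog : -Real.log (μ.real U) ≤ β / 16 := by linarith
        have h3 := Real.exp_le_exp.2 hlog
        rw [Real.exp_neg, Real.exp_log hUpos] at h3
        calc (1 : ℝ) = (μ.real U)⁻¹ * μ.real U := (inv_mul_cancel₀ hUpos.ne').symm
          _ ≤ Real.exp (β / 16) * μ.real U := mul_le_mul_of_nonneg_right h3 hUpos.le
      have h3 : Real.exp (-(1 / 8 * β)) * (Real.exp (-β) *
          (1 / 2 * Real.exp (β / 4) * Real.exp (β * (F 1 - 1 / 16)) * μ.real U)) =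
          Real.exp (-β) * Real.exp (β * F 1) / 2 * (Real.exp (β / 16) * μ.real U) := by
        have h4 : Real.exp (-(1 / 8 * β)) * Real.exp (β / 4) * Real.exp (β * (F 1 - 1 / 16)) =
            Real.exp (β * F 1) * Real.exp (β / 16) := by
          rw [← Real.exp_add, ← Real.exp_add, ← Real.exp_add]
          congr 1
          ring
        calc Real.exp (-(1 / 8 * β)) * (Real.exp (-β) *
              (1 / 2 * Real.exp (β / 4) * Real.exp (β * (F 1 - 1 / 16)) * μ.real U))
            = Real.exp (-β) / 2 * (Real.exp (-(1 / 8 * β)) * Real.exp (β / 4) *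
                Real.exp (β * (F 1 - 1 / 16))) * μ.real U := by ring
          _ = Real.exp (-β) * Real.exp (β * F 1) / 2 * (Real.exp (β / 16) * μ.real U) := by
              rw [h4]
              ring
      calc Real.exp (-β) * Real.exp (β * F 1) / 2 = Real.exp (-β) * Real.exp (β * F 1) / 2 * 1 :=
            (mul_one _).symm
        _ ≤ Real.exp (-β) * Real.exp (β * F 1) / 2 * (Real.exp (β / 16) * μ.real U) :=
            mul_le_mul_of_nonneg_left h2 (by positivity)
        _ = Real.exp (-(1 / 8 * β)) * (Real.exp (-β) *
              (1 / 2 * Real.exp (β / 4) * Real.exp (β * (F 1 - 1 / 16)) * μ.real U)) := h3.symm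
        _ ≤ Real.exp (-(1 / 8 * β)) * (Real.exp (-β) * ∫ h, w h * Real.exp (β * F h) ∂μ) := by
            gcongr
    exact hLHS.trans hRHS

/-! ### SPLIT for a kernel of order two and an adjoint-type blind weight -/

/-- **SPLIT, first rigorous instance (`|ker π| = 2`, adjoint-type weight; the datum
`SU(2) → SO(3)`, `ρH` fundamental, `r` vector).** In the context of `stub_centreSplitting`, assume
moreover that `ker π = {1, k₀}` with `k₀ ≠ 1`, that `ρH(k₀) = −1`, and that the centre-blind
weight is `Re tr r(π h) = (Re tr ρH(h))² − 1`. Then the stub's conclusion holds (with `c = 1/8`):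
for all large `β` there is a continuous, non-negative, symmetric, central, positive-type `w` on `H`
with `Σ_{k ∈ ker π} w(k h) = exp (β Re tr r(π h))` exactly and wrong-cell mass
`∫_{cell(1)} (exp (β Re tr r(π h)) − w) ≤ e^{−β/8} ∫ w` — the case `F = 0` of
`centreSplitting_of_kerOrderTwo_of_posType` (Gaussian subordination applied to `χ = Re tr ρH`,
scaled by `e^{−β}`). [folklore] -/
theorem centreSplitting_of_kerOrderTwo (G : Type) [Group G] [TopologicalSpace G]
    [IsTopologicalGroup G] [CompactSpace G] [MeasurableSpace G] [BorelSpace G]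
    (hG : Literature.MathematicalPhysics.QuantumFieldTheory.IsCompactSimpleLieGroup G) (H : Type)
    [Group H] [TopologicalSpace H] [IsTopologicalGroup H] [CompactSpace H] [MeasurableSpace H]
    [BorelSpace H] (hH : Literature.MathematicalPhysics.QuantumFieldTheory.IsCompactSimpleLieGroup H)
    (hH₁ : SimplyConnectedSpace H) (π : H →* G) (hπ : Continuous π) (hπs : Function.Surjective π)
    (hπZ : π.ker ≤ Subgroup.center H) (hπf : (π.ker : Set H).Finite) (hπ1 : π.ker ≠ ⊥)
    (ρH : Literature.MathematicalPhysics.QuantumFieldTheory.LatticeRep H)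
    (r : Literature.MathematicalPhysics.QuantumFieldTheory.LatticeRep G)
    (k₀ : H) (hk₀ : k₀ ∈ π.ker) (hk₀1 : k₀ ≠ 1) (hk2 : ∀ k ∈ π.ker, k = 1 ∨ k = k₀)
    (hρk : ρH.ρ k₀ = -1) (hr : ∀ h, (r.ρ (π h)).trace.re = (ρH.ρ h).trace.re ^ 2 - 1) :
    ∃ c : ℝ, 0 < c ∧ ∃ β_s : ℝ, ∀ β : ℝ, β_s ≤ β → (∃
    w : H → ℝ, Continuous w ∧ (∀ h, 0 ≤ w h) ∧ (∀ h, w h⁻¹ = w h) ∧ (∀ g h, w (g * h * g⁻¹) = w h) ∧ (∀ (n : ℕ) (x :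
    Fin n → H) (v : Fin n → ℂ), 0 ≤ (∑ i, ∑ j, (starRingEnd ℂ) (v i) * v j * ((w ((x i)⁻¹ * x j) : ℝ) : ℂ)).re) ∧ (∀
    h, ∑ᶠ k ∈ (π.ker : Set H), w (k * h) = Real.exp (β * (r.ρ (π h)).trace.re)) ∧ (∫ h in {h : H | (∀ k' : H, k' ∈
    π.ker → k' ≠ 1 → (ρH.ρ (k'⁻¹ * h)).trace.re < (ρH.ρ h).trace.re)}, (Real.exp (β * (r.ρ (π h)).trace.re) - w h)
    ∂(Literature.MathematicalPhysics.QuantumFieldTheory.haarProbability H) ≤ Real.exp (-(c * β)) * ∫ h, w h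
    ∂(Literature.MathematicalPhysics.QuantumFieldTheory.haarProbability H))) :=
  centreSplitting_of_kerOrderTwo_of_posType G hG H hH hH₁ π hπ hπs hπZ hπf hπ1 ρH r k₀ hk₀ hk₀1 hk2
    hρk (fun _ => 0) continuous_const (fun _ _ _ => rfl) (fun _ => rfl) (fun _ _ => rfl)
    (fun n x c => by simp) (fun h => by rw [hr, add_zero])

end Summit.QuantumFields.YangMills.Theorems.NonSimplyConnectedLatticeGap
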